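import Summits.HodgeConjecture.HodgeConjecture.Theorems.MarkmanPartnerTransportPartnerTransportRMGenerator
import Summits.HodgeConjecture.HodgeConjecture.Theorems.MarkmanPartnerTransportPicardThreeK3SquaresCellGenSocket
import Summits.HodgeConjecture.HodgeConjecture.Theorems.MarkmanPartnerTransportPartnerTransport
import Summits.HodgeConjecture.HodgeConjecture.Theorems.MarkmanPartnerTransportPartnerPicardRank

/-!
# Route MarkmanPartnerTransport · crux #5 `LowPicardRealMultiplication` (stmt-HodgeConjecture-19653) —
# «PARTNERED CELLS»: HC⁴(X) for every PARTNERED member of a cell from ONE algebraic class on its K3 partner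

Cell hodge-nonav, chapter ROUTE-P1AL; planner p1 g40 ASSIGN «PARTNER-RM-TYPE» (2026-08-28T18:03Z); prover seat
hodge-nonav-20241-p1 (gen 16). Leaf file (imports the route file through `…PartnerTransport`);
`--supports stmt-HodgeConjecture-19653` helper.

Composition of three tree results: «PARTNER-RM-TYPE» (`PartnerLattice.exists_generator_natDegree_of_partner_of_facts`:
the `X`-side RM datum `RMgen[X, φ, z, d]` descends along a K3 partner to a GENERATING `θ_S` with `(2,0)`-eigenvalue
of degree `d`), «K3-CELL-GEN SOCKET» (`OneCycle.hodgeConjectureFor_square_of_generatedBy_of_cycleInduced_natDegree`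
∕ `…_irrational_of_prime`: such a `θ_S` + ONE cycle-induced transcendental endomorphism of `S` with eigenvalue of
degree `d` — irrational if `d` is prime — give HC⁴(S ⊗ S), markings only), and support #2 `PartnerTransport`
(`PartnerLattice.partnerTransport_explicit`: HC⁴(S ⊗ S) ⟹ HC⁴(X)):

* `hodgeConjectureFor_of_partner_of_rmGenerator_of_cycleInduced_natDegree` (+ `…_irrational_of_prime`) —
  POINTWISE: marked smooth projective `K3^{[2]}`-type `(X, φ, P, z)` with `RMgen[X, φ, z, d]`, a K3 partner
  `(S, η, p, x, g)` ((g1), (g2), (g5) of the route's partner datum), and ONE cycle-induced `t` on `S` whose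
  `(2,0)`-eigenvalue has degree `d` (resp. is irrational, `d` prime) ⟹ `HodgeConjectureFor 4 X`;
* `partneredCellHC` ∕ `partneredCellHC_of_prime` — CELL-UNIFORM BY NAME: `PartneredCellHC[ρ, d]` (resp.
  `PartneredCellHCirr[ρ, d]`): every member of the cell `(ρ, d)` (`MarkedK3Sq`, `¬ SpannedByIsometries`,
  `ρ(X) = ρ`, `RMgen[X, φ, z, d]`) carrying a K3 partner whose surface has ONE cycle-induced `t` of eigenvalue
  degree `d` (resp. irrational) satisfies HC⁴ — for EVERY `(ρ, d)` (resp. every prime `d`), uniformly;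
* `partneredCellHC_32`, `…_35`, `…_23`, `…_27` (irrational form, `d` prime) and `…_34` (degree form) — the five
  partnered cells; **`(3,2)` explicitly**: there the K3-side degree law is silent (`ρ(S) = 2`, `20 = 2·2·5`, and
  `22 < 6·2 + 2` fails), so the known type `[E:ℚ] = 2` transported from `X` is what makes one quadratic cycle on
  the partner suffice.

OUT OF SCOPE — the orphan cell `(1,2)`: at `ρ(X) = 1` there is NO projective K3 partner (a partner has
`ρ(S) = ρ(X) − 1` by `finrank_algebraicClasses_succ_eq_of_partner`, and `ρ(S) = 0` is impossible for a projective
K3 surface, whose ample class is algebraic), so `PartneredCellHC[1, 2]` is vacuous and the cell `(1,2)` stays on the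
Kuga–Satake road (`cellHC_two_of_kugaSatake`). Likewise the orphan members of the other cells (no `-2`-vector in
`NS(X)_ℚ`, `…PartnerIffMinusTwo`) are not touched here.

CONDITIONAL on {`Beauville1983_hilbertSquare_markedIncidence`, `Beauville1983_hilbertSquare_blowupDiagonal_surjection`,
`Markman2024_rationalHodgeIsometry_lift_algebraic_marked`, `Voisin2003_cupProduct_algebraicClasses`,
`Huybrechts_K3_marking_exists`} and on the one-cycle clause (open geometry); NO Buskin, NO Verbitsky–Guan ∕ O'Grady ∕
Charles–Markman. Credits nothing; neither the crux nor HC is proved here. No definition, no sorry, no new named fact.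

References: E. Markman, Compos. Math. 160 (2024) Thm. 1.1, 1.4; A. Beauville, J. Differential Geom. 18 (1983) §6;
B. van Geemen, M. Schütt, Forum Math. Sigma 13 (2025) e2, §4.8, Rem. 4.9; Yu. G. Zarhin, J. reine angew. Math. 341
(1983) Thm. 1.5.1; M. Varesco, Math. Z. 305 (2023) §2.
-/

noncomputable section

set_option linter.dupNamespace false

open Module CategoryTheory MonoidalCategory Polynomial
open Literature.AlgebraicTopology.SingularHomology Literature.Geometry.Kaehler
open Literature.AlgebraicGeometry Literature.AlgebraicGeometry.Motives Literature.AlgebraicGeometry.HodgeTheory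
open Literature.AlgebraicGeometry.Hyperkaehler Literature.AlgebraicGeometry.Surfaces
open Literature.AlgebraicGeometry.HilbertScheme
open Summit.HodgeConjecture.HodgeConjecture.Theorems.NikulinTwinTransport

namespace Summit.HodgeConjecture.HodgeConjecture.Theorems.MarkmanPartnerTransport.PartnerLattice

/-- `MarkedK3Sq[X, φ, P, z]`: VERBATIM the `let MarkedK3Sq := …` binder of the route declarations of
MarkmanPartnerTransport (clauses (m1)–(m6)). Local notation only. -/
local notation3 (prettyPrint := false) "MarkedK3Sq[" X ", " φ ", " P ", " z "]" =>
  (((IsIntegralClass P ∧ ∀ Q : complexBetti X (2 * 4), IsIntegralClass Q → ∃ n : ℤ, Q = n • P) ∧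
    (∀ c : complexBetti X 2, IsIntegralClass c ↔ ∃ v : K3HilbertIndex → ℤ, φ c = fun i => (v i : ℂ)) ∧
    (∀ a : complexBetti X 2, cupPowTwo a 4 = ((3 : ℂ) * (k3HilbertForm 2 (φ a) (φ a)) ^ 2) • P) ∧
    (IsOfHodgeType 4 X 2 2 0 (LinearEquiv.symm φ z) ∧
      ∀ τ : complexBetti X 2, IsOfHodgeType 4 X 2 2 0 τ → ∃ t : ℂ, τ = t • LinearEquiv.symm φ z) ∧
    (∀ c : complexBetti X 2, IsOfHodgeType 4 X 2 1 1 c ↔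
      (k3HilbertForm 2 (φ c) z = 0 ∧ k3HilbertForm 2 (φ c) (star z) = 0)) ∧
    (k3HilbertForm 2 z z = 0 ∧ 0 < (k3HilbertForm 2 (star z) z).re)))

/-- `MarkedK3[S, η, p, x]`: VERBATIM the `let MarkedK3 := …` binder of the route declarations (`p ≠ 0`, the six
marking clauses, the projective period point). Local notation only. -/
local notation3 (prettyPrint := false) "MarkedK3[" S ", " η ", " p ", " x "]" =>
  (p ≠ 0 ∧ (IsIntegralClass p ∧
    (∀ q : complexBetti S (2 * 2), IsIntegralClass q → ∃ n : ℤ, q = n • p) ∧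
    (∀ c : complexBetti S (2 * 1), IsIntegralClass c ↔ ∃ v : K3Index → ℤ, η c = fun i => (v i : ℂ)) ∧
    (∀ a b : complexBetti S (2 * 1),
      cupProduct (rfl : 2 * 1 + 2 * 1 = 2 * 2) a b = k3Form (η a) (η b) • p) ∧
    IsOfHodgeType 2 S (2 * 1) 2 0 (LinearEquiv.symm η x) ∧
    (∀ τ : complexBetti S (2 * 1), IsOfHodgeType 2 S (2 * 1) 2 0 τ →
      ∃ t : ℂ, τ = t • LinearEquiv.symm η x)) ∧
    (k3Form x x = 0 ∧ 0 < (k3Form (star x) x).re ∧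
      ∃ u : K3Index → ℤ, k3Form (fun i => (u i : ℂ)) x = 0 ∧ 0 < ∑ i, ∑ j, u i * k3Gram i j * u j))

/-- `SpIso[X, φ]`: VERBATIM the `let SpannedByIsometries := …` binder of the route declarations (with
`IsBBFTransc` unfolded). Local notation only. -/
local notation3 (prettyPrint := false) "SpIso[" X ", " φ "]" =>
  (∀ f : complexBetti X 2 →ₗ[ℂ] complexBetti X 2, (∀ y, IsRationalClass y → IsRationalClass (f y)) →
    (∀ (i j : ℕ) y, IsOfHodgeType 4 X 2 i j y → IsOfHodgeType 4 X 2 i j (f y)) →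
    (∀ d : complexBetti X 2, d ∈ algebraicClasses X 1 → f d = 0) →
    (∀ y : complexBetti X 2, ∀ d : complexBetti X 2, d ∈ algebraicClasses X 1 →
      k3HilbertForm 2 (φ (f y)) (φ d) = 0) →
    ∃ (k : ℕ) (c : Fin k → ℚ) (g : Fin k → (complexBetti X 2 →ₗ[ℂ] complexBetti X 2)),
      (∀ i, Function.Bijective (g i) ∧ (∀ y, IsRationalClass y → IsRationalClass (g i y)) ∧
        (∀ (a b : ℕ) y, IsOfHodgeType 4 X 2 a b y → IsOfHodgeType 4 X 2 a b (g i y)) ∧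
        (∀ a b, k3HilbertForm 2 (φ (g i a)) (φ (g i b)) = k3HilbertForm 2 (φ a) (φ b))) ∧
      ∀ y : complexBetti X 2, (∀ d : complexBetti X 2, d ∈ algebraicClasses X 1 →
        k3HilbertForm 2 (φ y) (φ d) = 0) → f y = ∑ i : Fin k, ((c i : ℂ) • g i y))

/-- `RMgen[X, φ, z, d]` (VERBATIM `…LowPicardRMCells`). Local notation only. -/
local notation3 (prettyPrint := false) "RMgen[" X ", " φ ", " z ", " d "]" =>
  (∃ θ : complexBetti X 2 →ₗ[ℂ] complexBetti X 2, (∀ y, IsRationalClass y → IsRationalClass (θ y)) ∧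
    (∀ (i j : ℕ) y, IsOfHodgeType 4 X 2 i j y → IsOfHodgeType 4 X 2 i j (θ y)) ∧
    (∀ y w : complexBetti X 2, k3HilbertForm 2 (φ (θ y)) (φ w) = k3HilbertForm 2 (φ y) (φ (θ w))) ∧
    ∃ ev : ℂ, θ (LinearEquiv.symm φ z) = ev • LinearEquiv.symm φ z ∧ ev.im = 0 ∧
      (minpoly ℚ ev).natDegree = d ∧
      (∃ n : ℕ, 3 ≤ n ∧ d * n + Module.finrank ℂ ↥(algebraicClasses X 1) = 23) ∧
      ∀ f : complexBetti X 2 →ₗ[ℂ] complexBetti X 2, (∀ y, IsRationalClass y → IsRationalClass (f y)) →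
        (∀ (i j : ℕ) y, IsOfHodgeType 4 X 2 i j y → IsOfHodgeType 4 X 2 i j (f y)) →
        ∃ c : Fin d → ℚ, ∀ y : complexBetti X 2,
          (∀ a : complexBetti X 2, a ∈ algebraicClasses X 1 → k3HilbertForm 2 (φ y) (φ a) = 0) →
            f y = ∑ i : Fin d, ((c i : ℂ) • (θ ^ (i : ℕ)) y))

/-- `Partner[X, φ, S, η, g]`: clauses (g1), (g2), (g5) of the route's `IsK3Partner` datum — `g : H²(S) → H²(X)`
rational, type-preserving, isometric on cup-transcendental classes (the clauses `partnerTransport_explicit` uses).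
Local notation only. -/
local notation3 (prettyPrint := false) "Partner[" X ", " φ ", " S ", " η ", " g "]" =>
  ((∀ a, IsRationalClass a → IsRationalClass (g a)) ∧
    (∀ (i j : ℕ) a, IsOfHodgeType 2 S (2 * 1) i j a → IsOfHodgeType 4 X 2 i j (g a)) ∧
    (∀ a b, (∀ d ∈ algebraicClasses S 1, cupProduct (rfl : 2 * 1 + 2 * 1 = 2 * 2) a d = 0) →
      (∀ d ∈ algebraicClasses S 1, cupProduct (rfl : 2 * 1 + 2 * 1 = 2 * 2) b d = 0) →
      k3HilbertForm 2 (φ (g a)) (φ (g b)) = k3Form (η a) (η b)))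

/-- `OneCycleK3[S, hS, d]`: ONE cycle-induced transcendental endomorphism of the K3 surface `S` (rational,
type-preserving, kills `N¹`, image `⊥ N¹`, induced by an algebraic class on `S × S`) whose `(2,0)`-eigenvalue has
minimal polynomial of degree `d`. Local notation only. -/
local notation3 (prettyPrint := false) "OneCycleK3[" S ", " hS ", " d "]" =>
  (∃ t : complexBetti S (2 * 1) →ₗ[ℂ] complexBetti S (2 * 1),
    IsCycleInducedTranscendentalEndomorphism S (IsK3Surface.isSmoothProjective hS) t ∧
    ∃ (σ₁ : complexBetti S (2 * 1)) (ev : ℂ), IsOfHodgeType 2 S (2 * 1) 2 0 σ₁ ∧ σ₁ ≠ 0 ∧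
      t σ₁ = ev • σ₁ ∧ (minpoly ℚ ev).natDegree = d)

/-- `OneIrrCycleK3[S, hS]`: ONE cycle-induced transcendental endomorphism of `S` with an IRRATIONAL
`(2,0)`-eigenvalue. Local notation only. -/
local notation3 (prettyPrint := false) "OneIrrCycleK3[" S ", " hS "]" =>
  (∃ t : complexBetti S (2 * 1) →ₗ[ℂ] complexBetti S (2 * 1),
    IsCycleInducedTranscendentalEndomorphism S (IsK3Surface.isSmoothProjective hS) t ∧
    ∃ (σ₁ : complexBetti S (2 * 1)) (ev : ℂ), IsOfHodgeType 2 S (2 * 1) 2 0 σ₁ ∧ σ₁ ≠ 0 ∧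
      t σ₁ = ev • σ₁ ∧ ∀ a : ℚ, (a : ℂ) ≠ ev)

/-- `PartneredCellHC[ρ, d]`: **HC⁴ on the PARTNERED part of the cell `(ρ, d)`, from one cycle of degree `d` on the
partner** — every member `(X, φ, P, z)` of the cell (`MarkedK3Sq`, `¬ SpannedByIsometries`, `ρ(X) = ρ`,
`RMgen[X, φ, z, d]`) with a K3 partner `(S, η, p, x, g)` whose surface carries `OneCycleK3[S, hS, d]` satisfies
`HodgeConjectureFor 4 X`. Local notation only. -/
local notation3 (prettyPrint := false) "PartneredCellHC[" ρ ", " d "]" =>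
  (∀ (X : SchemeOver ℂ), IsSmoothProjective 4 X → IsOfK3HilbertSquareType X →
    ∀ (φ : complexBetti X 2 ≃ₗ[ℂ] (K3HilbertIndex → ℂ)) (P : complexBetti X (2 * 4)) (z : K3HilbertIndex → ℂ),
      MarkedK3Sq[X, φ, P, z] → ¬ SpIso[X, φ] → Module.finrank ℂ ↥(algebraicClasses X 1) = ρ →
        RMgen[X, φ, z, d] →
        ∀ (S : SchemeOver ℂ) (hS : IsK3Surface S) (η : complexBetti S (2 * 1) ≃ₗ[ℂ] (K3Index → ℂ))
          (p : complexBetti S (2 * 2)) (x : K3Index → ℂ) (g : complexBetti S (2 * 1) →ₗ[ℂ] complexBetti X 2),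
          MarkedK3[S, η, p, x] → Partner[X, φ, S, η, g] → OneCycleK3[S, hS, d] → HodgeConjectureFor 4 X)

/-- `PartneredCellHCirr[ρ, d]`: the same with `OneIrrCycleK3[S, hS]` (one cycle with an irrational eigenvalue on the
partner) — the right input when `d` is prime. Local notation only. -/
local notation3 (prettyPrint := false) "PartneredCellHCirr[" ρ ", " d "]" =>
  (∀ (X : SchemeOver ℂ), IsSmoothProjective 4 X → IsOfK3HilbertSquareType X →
    ∀ (φ : complexBetti X 2 ≃ₗ[ℂ] (K3HilbertIndex → ℂ)) (P : complexBetti X (2 * 4)) (z : K3HilbertIndex → ℂ),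
      MarkedK3Sq[X, φ, P, z] → ¬ SpIso[X, φ] → Module.finrank ℂ ↥(algebraicClasses X 1) = ρ →
        RMgen[X, φ, z, d] →
        ∀ (S : SchemeOver ℂ) (hS : IsK3Surface S) (η : complexBetti S (2 * 1) ≃ₗ[ℂ] (K3Index → ℂ))
          (p : complexBetti S (2 * 2)) (x : K3Index → ℂ) (g : complexBetti S (2 * 1) →ₗ[ℂ] complexBetti X 2),
          MarkedK3[S, η, p, x] → Partner[X, φ, S, η, g] → OneIrrCycleK3[S, hS] → HodgeConjectureFor 4 X)

variable {X S : SchemeOver ℂ} {φ : complexBetti X 2 ≃ₗ[ℂ] (K3HilbertIndex → ℂ)} {P : complexBetti X (2 * 4)}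
  {z : K3HilbertIndex → ℂ} {η : complexBetti S (2 * 1) ≃ₗ[ℂ] (K3Index → ℂ)} {p : complexBetti S (2 * 2)}
  {x : K3Index → ℂ}

/-! ### §1 Pointwise: one cycle on the partner of an RM fourfold of known type -/

/-- **HC⁴(X) for a marked `K3^{[2]}`-type fourfold with RM datum of degree `d`, a K3 partner, and ONE cycle-induced
endomorphism of the partner with `(2,0)`-eigenvalue of degree `d`** (module docstring: «PARTNER-RM-TYPE» ⟹
«K3-CELL-GEN SOCKET» ⟹ `PartnerTransport`). Modulo the five displayed facts; no Buskin, no Verbitsky–Guan ∕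
O'Grady ∕ Charles–Markman. [cite: Markman2024, §1.1 Thm. 1.1 and Thm. 1.4] [cite: Beauville1983, §6 (e)–(f), Prop. 6]
[cite: GeemenSchutt2023, §4.8 and Rem. 4.9] [cite: Zarhin1983HodgeGroupsK3, Thm. 1.5.1] -/
theorem hodgeConjectureFor_of_partner_of_rmGenerator_of_cycleInduced_natDegree
    (hBI : Beauville1983_hilbertSquare_markedIncidence)
    (hBea : Beauville1983_hilbertSquare_blowupDiagonal_surjection)
    (hMk : Markman2024_rationalHodgeIsometry_lift_algebraic_marked)
    (hcup : Voisin2003_cupProduct_algebraicClasses) (hmark : Huybrechts_K3_marking_exists)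
    (hX : IsSmoothProjective 4 X) (hK : IsOfK3HilbertSquareType X) (hM : MarkedK3Sq[X, φ, P, z]) {d : ℕ}
    (hR : RMgen[X, φ, z, d]) (hS : IsK3Surface S) (hMS : MarkedK3[S, η, p, x])
    {g : complexBetti S (2 * 1) →ₗ[ℂ] complexBetti X 2} (hg : Partner[X, φ, S, η, g])
    (t : complexBetti S (2 * 1) →ₗ[ℂ] complexBetti S (2 * 1))
    (ht : IsCycleInducedTranscendentalEndomorphism S hS.isSmoothProjective t)
    (ht_ev : ∃ (σ₁ : complexBetti S (2 * 1)) (ev : ℂ), IsOfHodgeType 2 S (2 * 1) 2 0 σ₁ ∧ σ₁ ≠ 0 ∧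
      t σ₁ = ev • σ₁ ∧ (minpoly ℚ ev).natDegree = d) :
    HodgeConjectureFor 4 X := by
  obtain ⟨hp0, hmk, hxx, hxpos, hu⟩ := hMS
  obtain ⟨hg1, hg2, hg5⟩ := hg
  obtain ⟨θS, h1, h2, hgen, ev₀, hev₀, -, hdeg₀⟩ :=
    exists_generator_natDegree_of_partner_of_facts hBI hcup hX hM hS hp0 hmk hxx hxpos hu hg1 hg2 hg5 hR
  have h20 : IsOfHodgeType 2 S (2 * 1) 2 0 (η.symm x) := hmk.2.2.2.2.1
  have hxne : η.symm x ≠ 0 := fun h0 => ne_zero_of_star_self_re_pos hxpos (by simpa using congrArg η h0)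
  exact partnerTransport_explicit hBI hBea hMk hcup hX hK hM hS hmk hxx hxpos hu hg1 hg2 hg5
    (OneCycle.hodgeConjectureFor_square_of_generatedBy_of_cycleInduced_natDegree hmark hS θS h1 h2 hgen
      ⟨η.symm x, ev₀, h20, hxne, hev₀, hdeg₀⟩ t ht ht_ev)

/-- **The same for `d` PRIME with ONE cycle of IRRATIONAL eigenvalue on the partner** (the five prime cells
`(1,2)`—vacuously, no partner—, `(2,3)`, `(2,7)`, `(3,2)`, `(3,5)`). [cite: Markman2024, §1.1 Thm. 1.1 and Thm. 1.4]
[cite: Beauville1983, §6 Prop. 6] [cite: GeemenSchutt2023, §4.8 and Rem. 4.9] -/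
theorem hodgeConjectureFor_of_partner_of_rmGenerator_of_cycleInduced_irrational_of_prime
    (hBI : Beauville1983_hilbertSquare_markedIncidence)
    (hBea : Beauville1983_hilbertSquare_blowupDiagonal_surjection)
    (hMk : Markman2024_rationalHodgeIsometry_lift_algebraic_marked)
    (hcup : Voisin2003_cupProduct_algebraicClasses) (hmark : Huybrechts_K3_marking_exists)
    (hX : IsSmoothProjective 4 X) (hK : IsOfK3HilbertSquareType X) (hM : MarkedK3Sq[X, φ, P, z]) {d : ℕ}
    (hp : d.Prime) (hR : RMgen[X, φ, z, d]) (hS : IsK3Surface S) (hMS : MarkedK3[S, η, p, x])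
    {g : complexBetti S (2 * 1) →ₗ[ℂ] complexBetti X 2} (hg : Partner[X, φ, S, η, g])
    (t : complexBetti S (2 * 1) →ₗ[ℂ] complexBetti S (2 * 1))
    (ht : IsCycleInducedTranscendentalEndomorphism S hS.isSmoothProjective t)
    (ht_ev : ∃ (σ₁ : complexBetti S (2 * 1)) (ev : ℂ), IsOfHodgeType 2 S (2 * 1) 2 0 σ₁ ∧ σ₁ ≠ 0 ∧
      t σ₁ = ev • σ₁ ∧ ∀ a : ℚ, (a : ℂ) ≠ ev) :
    HodgeConjectureFor 4 X := by
  obtain ⟨hp0, hmk, hxx, hxpos, hu⟩ := hMS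
  obtain ⟨hg1, hg2, hg5⟩ := hg
  obtain ⟨θS, h1, h2, hgen, ev₀, hev₀, -, hdeg₀⟩ :=
    exists_generator_natDegree_of_partner_of_facts hBI hcup hX hM hS hp0 hmk hxx hxpos hu hg1 hg2 hg5 hR
  have h20 : IsOfHodgeType 2 S (2 * 1) 2 0 (η.symm x) := hmk.2.2.2.2.1
  have hxne : η.symm x ≠ 0 := fun h0 => ne_zero_of_star_self_re_pos hxpos (by simpa using congrArg η h0)
  exact partnerTransport_explicit hBI hBea hMk hcup hX hK hM hS hmk hxx hxpos hu hg1 hg2 hg5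
    (OneCycle.hodgeConjectureFor_square_of_generatedBy_of_cycleInduced_irrational_of_prime hmark hS θS h1 h2 hgen hp
      ⟨η.symm x, ev₀, h20, hxne, hev₀, hdeg₀⟩ t ht ht_ev)

/-! ### §2 Cell-uniform, BY NAME -/

/-- **`PartneredCellHC[ρ, d]` for EVERY `(ρ, d)`** — the partnered part of each cell of crux #5 follows from ONE
cycle-induced endomorphism of eigenvalue degree `d` on the partner surface, uniformly (the known type `[E:ℚ] = d`
travels with the partner, so no K3-side degree law is needed). Modulo the five displayed facts.
[cite: Markman2024, §1.1 Thm. 1.1 and Thm. 1.4] [cite: GeemenSchutt2023, §4.8 and Rem. 4.9] -/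
theorem partneredCellHC (hBI : Beauville1983_hilbertSquare_markedIncidence)
    (hBea : Beauville1983_hilbertSquare_blowupDiagonal_surjection)
    (hMk : Markman2024_rationalHodgeIsometry_lift_algebraic_marked)
    (hcup : Voisin2003_cupProduct_algebraicClasses) (hmark : Huybrechts_K3_marking_exists) (ρ d : ℕ) :
    PartneredCellHC[ρ, d] := by
  intro X hX hK φ P z hM _ _ hR S hS η p x g hMS hg hcyc
  obtain ⟨t, ht, ht_ev⟩ := hcyc
  exact hodgeConjectureFor_of_partner_of_rmGenerator_of_cycleInduced_natDegree hBI hBea hMk hcup hmark hX hK hM hR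
    hS hMS hg t ht ht_ev

/-- **`PartneredCellHCirr[ρ, d]` for every PRIME `d`** — one cycle with an IRRATIONAL eigenvalue on the partner.
[cite: Markman2024, §1.1 Thm. 1.1 and Thm. 1.4] [cite: GeemenSchutt2023, §4.8 and Rem. 4.9] -/
theorem partneredCellHC_of_prime (hBI : Beauville1983_hilbertSquare_markedIncidence)
    (hBea : Beauville1983_hilbertSquare_blowupDiagonal_surjection)
    (hMk : Markman2024_rationalHodgeIsometry_lift_algebraic_marked)
    (hcup : Voisin2003_cupProduct_algebraicClasses) (hmark : Huybrechts_K3_marking_exists) (ρ : ℕ) {d : ℕ}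
    (hp : d.Prime) : PartneredCellHCirr[ρ, d] := by
  intro X hX hK φ P z hM _ _ hR S hS η p x g hMS hg hcyc
  obtain ⟨t, ht, ht_ev⟩ := hcyc
  exact hodgeConjectureFor_of_partner_of_rmGenerator_of_cycleInduced_irrational_of_prime hBI hBea hMk hcup hmark hX
    hK hM hp hR hS hMS hg t ht ht_ev

/-- **The quadratic cell `(3,2)`, partnered part** (`ρ(X) = 3`, `E(X)` real quadratic; partner `ρ(S) = 2`,
rank `T(S) = 20 = 2·2·5`): ONE cycle-induced endomorphism of the partner with an IRRATIONAL eigenvalue suffices —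
although on the K3 side alone a quadratic eigenvalue at `ρ(S) = 2` does NOT decide generation (`E(S)` could be
totally real quartic; `…OneCycleDegree` and `…_six_mul_lt` are silent), the type `[E:ℚ] = 2` transported from `X`
does. No Kuga–Satake. [cite: Markman2024, §1.1 Thm. 1.1] [cite: Vangeemen2008, Lemma 3.2] [cite: GeemenSchutt2023, §4.8] -/
theorem partneredCellHC_32 (hBI : Beauville1983_hilbertSquare_markedIncidence)
    (hBea : Beauville1983_hilbertSquare_blowupDiagonal_surjection)
    (hMk : Markman2024_rationalHodgeIsometry_lift_algebraic_marked)
    (hcup : Voisin2003_cupProduct_algebraicClasses) (hmark : Huybrechts_K3_marking_exists) :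
    PartneredCellHCirr[3, 2] :=
  partneredCellHC_of_prime hBI hBea hMk hcup hmark 3 Nat.prime_two

/-- **The quintic cell `(3,5)`, partnered part** (partner `ρ(S) = 2`, `[E:ℚ] = 5`; e.g. partners of van
Geemen–Schütt's `ℚ(ζ₁₁ + ζ₁₁⁻¹)` surfaces): one cycle with an irrational eigenvalue on the partner suffices.
[cite: GeemenSchutt2023, Thm. 1.1 (11) and §4.8] [cite: Markman2024, §1.1 Thm. 1.1] -/
theorem partneredCellHC_35 (hBI : Beauville1983_hilbertSquare_markedIncidence)
    (hBea : Beauville1983_hilbertSquare_blowupDiagonal_surjection)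
    (hMk : Markman2024_rationalHodgeIsometry_lift_algebraic_marked)
    (hcup : Voisin2003_cupProduct_algebraicClasses) (hmark : Huybrechts_K3_marking_exists) :
    PartneredCellHCirr[3, 5] :=
  partneredCellHC_of_prime hBI hBea hMk hcup hmark 3 (by norm_num)

/-- **The cubic cell `(2,3)`, partnered part** (partner `ρ(S) = 1`, `[E:ℚ] = 3`).
[cite: GeemenSchutt2023, Thm. 3.14 and §4.8] [cite: Markman2024, §1.1 Thm. 1.1] -/
theorem partneredCellHC_23 (hBI : Beauville1983_hilbertSquare_markedIncidence)
    (hBea : Beauville1983_hilbertSquare_blowupDiagonal_surjection)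
    (hMk : Markman2024_rationalHodgeIsometry_lift_algebraic_marked)
    (hcup : Voisin2003_cupProduct_algebraicClasses) (hmark : Huybrechts_K3_marking_exists) :
    PartneredCellHCirr[2, 3] :=
  partneredCellHC_of_prime hBI hBea hMk hcup hmark 2 Nat.prime_three

/-- **The septic cell `(2,7)`, partnered part** (partner `ρ(S) = 1`, `[E:ℚ] = 7`).
[cite: GeemenSchutt2023, Thm. 3.19 and §4.8] [cite: Markman2024, §1.1 Thm. 1.1] -/
theorem partneredCellHC_27 (hBI : Beauville1983_hilbertSquare_markedIncidence)
    (hBea : Beauville1983_hilbertSquare_blowupDiagonal_surjection)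
    (hMk : Markman2024_rationalHodgeIsometry_lift_algebraic_marked)
    (hcup : Voisin2003_cupProduct_algebraicClasses) (hmark : Huybrechts_K3_marking_exists) :
    PartneredCellHCirr[2, 7] :=
  partneredCellHC_of_prime hBI hBea hMk hcup hmark 2 (by norm_num)

/-- **The quartic cell `(3,4)`, partnered part** (partner `ρ(S) = 2`, `[E:ℚ] = 4`; `4` is not prime, so the
input is one cycle whose eigenvalue has degree EXACTLY `4` — cf. the K3-side «QUARTIC SOCKET»).
[cite: GeemenSchutt2023, Thm. 3.18 and §4.8] [cite: Markman2024, §1.1 Thm. 1.1] -/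
theorem partneredCellHC_34 (hBI : Beauville1983_hilbertSquare_markedIncidence)
    (hBea : Beauville1983_hilbertSquare_blowupDiagonal_surjection)
    (hMk : Markman2024_rationalHodgeIsometry_lift_algebraic_marked)
    (hcup : Voisin2003_cupProduct_algebraicClasses) (hmark : Huybrechts_K3_marking_exists) :
    PartneredCellHC[3, 4] :=
  partneredCellHC hBI hBea hMk hcup hmark 3 4

/-! ### Appended (gen 16, rider «PARTNER-PICARD BY NAME», p1 g40 18:19Z): the partner of a member of the
cell `(ρ, d)` has Picard number `ρ − 1`

Under the FULL partner datum (here (g1), (g2), (g4) image `q`-orthogonal to `N¹(X)`, (g5), (g6) onto `T(X)_ℂ`), the K3 partner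
`S` of a member `X` of the cell `(ρ, d)` has `ρ(S) + 1 = ρ`: so `PartneredCellHC[ρ, d]` reads against the K3 «cell»
`(ρ − 1, d)` — `(3,5), (3,4), (3,2) ↦ ρ(S) = 2`; `(2,3), (2,7) ↦ ρ(S) = 1`; `(1,2) ↦ ρ(S) = 0`, i.e. NO partner. -/

/-- `PartnerFull[X, φ, S, η, g]`: clauses (g1), (g2), (g4), (g5), (g6) of the route's `IsK3Partner` datum (rational;
type-preserving; image `q`-orthogonal to `N¹(X)`; isometric on cup-transcendental classes; onto the `q`-transcendental
classes). Local notation only. -/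
local notation3 (prettyPrint := false) "PartnerFull[" X ", " φ ", " S ", " η ", " g "]" =>
  ((∀ a, IsRationalClass a → IsRationalClass (g a)) ∧
    (∀ (i j : ℕ) a, IsOfHodgeType 2 S (2 * 1) i j a → IsOfHodgeType 4 X 2 i j (g a)) ∧
    (∀ a, ∀ d : complexBetti X 2, d ∈ algebraicClasses X 1 → k3HilbertForm 2 (φ (g a)) (φ d) = 0) ∧
    (∀ a b, (∀ d ∈ algebraicClasses S 1, cupProduct (rfl : 2 * 1 + 2 * 1 = 2 * 2) a d = 0) →
      (∀ d ∈ algebraicClasses S 1, cupProduct (rfl : 2 * 1 + 2 * 1 = 2 * 2) b d = 0) →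
      k3HilbertForm 2 (φ (g a)) (φ (g b)) = k3Form (η a) (η b)) ∧
    (∀ y : complexBetti X 2,
      (∀ d : complexBetti X 2, d ∈ algebraicClasses X 1 → k3HilbertForm 2 (φ y) (φ d) = 0) →
        ∃ a : complexBetti S (2 * 1),
          (∀ d ∈ algebraicClasses S 1, cupProduct (rfl : 2 * 1 + 2 * 1 = 2 * 2) a d = 0) ∧ g a = y))

/-- **«PARTNER-PICARD»: `ρ(S) + 1 = ρ(X)` for a K3 partner with the full datum**, from Beauville's marked incidence:
`ρ(X) ≤ ρ(S) + 1` (`finrank_algebraicClasses_le_partner_succ`: the transcendental lattices along `S ↪ S^{[2]} ≃ X`) and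
`ρ(S) + 1 ≤ ρ(X)` from the onto clause (`finrank_algebraicClasses_succ_eq_of_partner`). Modulo
{`Beauville1983_hilbertSquare_markedIncidence`, `Voisin2003_cupProduct_algebraicClasses`}.
[cite: Beauville1983, §6 Prop. 6 and Remarque] [cite: Huybrechts2016K3, Ch. 3 Def. 2.5 and Lemma 3.1] -/
theorem finrank_algebraicClasses_partner_succ_eq_of_facts (hBI : Beauville1983_hilbertSquare_markedIncidence)
    (hcup : Voisin2003_cupProduct_algebraicClasses) (hX : IsSmoothProjective 4 X) (hM : MarkedK3Sq[X, φ, P, z])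
    (hS : IsK3Surface S) (hMS : MarkedK3[S, η, p, x]) {g : complexBetti S (2 * 1) →ₗ[ℂ] complexBetti X 2}
    (hg : PartnerFull[X, φ, S, η, g]) :
    Module.finrank ℂ ↥(algebraicClasses S 1) + 1 = Module.finrank ℂ ↥(algebraicClasses X 1) := by
  obtain ⟨hp0, hmk, hxx, hxpos, hu⟩ := hMS
  obtain ⟨hg1, -, hg4, hg5, hg6⟩ := hg
  have hμ := hasPoincareDuality_complexOrientationFamily
  obtain ⟨H, hH, Ξ, φH, PH, -, -, hMH, θ, hθ, hi⟩ := hBI complexOrientationFamily hμ S hS η p x hmk hxx hxpos hu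
  have hle := finrank_algebraicClasses_le_partner_succ hcup hμ hX hM hS hp0 hmk.2.2.1 hmk.2.2.2.1
    hmk.2.2.2.2.1 hxpos hH hMH hθ hi hg1 hg4 hg5
  exact finrank_algebraicClasses_succ_eq_of_partner φ η hp0 hmk.2.2.2.1 g hg6 hle

/-- **The partner of a member of the cell `(ρ, d)` lies in the K3 «cell» `(ρ − 1, d)`**: `ρ(S) = ρ − 1` (with the full
partner datum), and — «PARTNER-RM-TYPE» — `S` carries a generating endomorphism of `(2,0)`-eigenvalue degree `d`
(`K3Gen`, `exists_generator_natDegree_of_partner_of_facts`). In particular a member of the orphan cell `(1,2)` has NO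
such partner (`ρ(S) = 0` contradicts the positive rational vector `u` of the projective period point — recorded here only
as the arithmetic `ρ(S) = ρ − 1`). Modulo {Beauville incidence, Voisin cup}. [cite: Beauville1983, §6 Prop. 6]
[cite: Huybrechts2016K3, Ch. 3 Lemma 3.1] [cite: Zarhin1983HodgeGroupsK3, Thm. 1.5.1] -/
theorem partner_mem_K3cell_of_cell (hBI : Beauville1983_hilbertSquare_markedIncidence)
    (hcup : Voisin2003_cupProduct_algebraicClasses) (hX : IsSmoothProjective 4 X) (hM : MarkedK3Sq[X, φ, P, z]) {ρ d : ℕ}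
    (hρ : Module.finrank ℂ ↥(algebraicClasses X 1) = ρ) (hR : RMgen[X, φ, z, d]) (hS : IsK3Surface S)
    (hMS : MarkedK3[S, η, p, x]) {g : complexBetti S (2 * 1) →ₗ[ℂ] complexBetti X 2} (hg : PartnerFull[X, φ, S, η, g]) :
    Module.finrank ℂ ↥(algebraicClasses S 1) = ρ - 1 ∧
      ∃ θS : complexBetti S (2 * 1) →ₗ[ℂ] complexBetti S (2 * 1),
        (∀ y, IsRationalClass y → IsRationalClass (θS y)) ∧
        (∀ (i j : ℕ) y, IsOfHodgeType 2 S (2 * 1) i j y → IsOfHodgeType 2 S (2 * 1) i j (θS y)) ∧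
        TranscendentalEndomorphismsGeneratedBy S θS ∧
        ∃ ev : ℂ, θS (LinearEquiv.symm η x) = ev • LinearEquiv.symm η x ∧ ev.im = 0 ∧
          (minpoly ℚ ev).natDegree = d := by
  have h1 := finrank_algebraicClasses_partner_succ_eq_of_facts hBI hcup hX hM hS hMS hg
  obtain ⟨hp0, hmk, hxx, hxpos, hu⟩ := hMS
  obtain ⟨hg1, hg2, -, hg5, -⟩ := hg
  exact ⟨by omega, exists_generator_natDegree_of_partner_of_facts hBI hcup hX hM hS hp0 hmk hxx hxpos hu hg1 hg2 hg5 hR⟩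

end Summit.HodgeConjecture.HodgeConjecture.Theorems.MarkmanPartnerTransport.PartnerLattice

end
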